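import Mathlib
import HarnessLib
import Summits.AtomisticToContinuum.FouriersLaw.Theses.JunctionLocality
import Summits.AtomisticToContinuum.FouriersLaw.Theorems.JunctionLocalitySuperadditiveResistanceDeviceLiouville
import Summits.AtomisticToContinuum.FouriersLaw.Theorems.BondHeatUncertaintySubdiffusiveBondHeatKernelGibbsF

/-!
# Kubo link, helper II: the equilibrium Poisson field `∫₀^∞ (P_u f − μ_T f) du` of the plain chain
(stub `stub_plainKuboLink` of line `floating-probe-bypass-laplacian`, crux stmt-AtomisticToContinuum-11748)

Second helper file towards the Green–Kubo identification `⟨g, p_0² − T⟩_{μ_T} = ∫₀^∞ K_L(u) du` of the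
forward field of the plain `L`-chain (see helper I for the context). For the pinned anharmonic chain
`pinnedChain ω₂ lam β γ` (all parameters `> 0`), `N ≥ 1`, `T > 0`, the constructed transition kernels
`P_u = transitionKernel N T T u` at equal bath temperatures and the Gibbs measure `μ_T`:

* `poissonField` — `G_f(z) := ∫_{u>0} (P_u f(z) − μ_T(f)) du`, the semigroup solution of the Poisson
  equation `−L G_f = f − μ_T(f)`;
* `act_sub_mean_decay` — for continuous `|f| ≤ M e^{ϑH}` (`0 < ϑ < 1/T`):
  `|P_u f(z) − μ_T(f)| ≤ M C e^{ϑH(z)} e^{−cu}` with `C, c` depending on `ϑ` only (the proved exponential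
  ergodicity `pinnedChain_exp_convergence_gibbs`, CEHR 2018 Thm 2.13 (3) with the limit identified);
* `abs_poissonField_le`, `stronglyMeasurable_poissonField`, `memLp_poissonField`, `integral_poissonField` —
  `|G_f| ≤ M C c⁻¹ e^{ϑH}`, measurable, in `L²(μ_T)` for `2ϑ < 1/T`, mean zero (kernel invariance of `μ_T`);
* `integral_mul_poissonField` — Fubini: `∫ h G_f dμ_T = ∫_{u>0} ∫ h (P_u f − μ_T f) dμ_T du` for continuous
  `|h| ≤ M' e^{ϑ'H}`, `ϑ + ϑ' < 1/T`; with `h = f = p_0² − T` this is `⟨G, p_0² − T⟩_{μ_T} = ∫₀^∞ K_N`;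
* `tendsto_poissonField` — dominated convergence `G_{f_n}(z) → G_f(z)` along pointwise convergent,
  uniformly `e^{ϑH}`-dominated continuous `f_n`.
-/

noncomputable section

open MeasureTheory Filter Topology Set ProbabilityTheory
open scoped ContDiff NNReal ENNReal
open Literature.MathematicalPhysics.KineticTheory.HeatConduction
open Literature.MathematicalPhysics.KineticTheory Literature.Probability.Process OscillatorChain
open Summit.AtomisticToContinuum.FouriersLaw.Theorems.SubdiffusiveBondHeat

namespace Summit.AtomisticToContinuum.FouriersLaw.Cruxes.SuperadditiveResistance.FloatingProbeBypassLaplacian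

/-- The CENTRED SEMIGROUP ACTION `P_{u⁺} f(z) − μ_T(f)` of the plain `N`-chain at temperature `T`
(constructed transition kernels at equal bath temperatures; `u⁺ = max(u,0)`). -/
def actCentered (ω₂ lam β γ T : ℝ) (N : ℕ) (f : PhaseSpace N → ℝ) (u : ℝ) (z : PhaseSpace N) : ℝ :=
  (∫ y, f y ∂((pinnedChain ω₂ lam β γ).transitionKernel N T T u.toNNReal z)) -
    ∫ y, f y ∂((pinnedChain ω₂ lam β γ).gibbsMeasure N T)

/-- The equilibrium POISSON FIELD of an observable `f` for the plain `N`-chain at temperature `T`: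
`G_f(z) = ∫_{u>0} (P_u f(z) − μ_T(f)) du`. For `f = p_0² − T` this is the semigroup forward field
`∫₀^∞ P_u(p_0² − T) du`. -/
def poissonField (ω₂ lam β γ T : ℝ) (N : ℕ) (f : PhaseSpace N → ℝ) (z : PhaseSpace N) : ℝ :=
  ∫ u in Ioi (0 : ℝ), actCentered ω₂ lam β γ T N f u z

/-- Unfolding `actCentered`. -/
theorem actCentered_apply (ω₂ lam β γ T : ℝ) (N : ℕ) (f : PhaseSpace N → ℝ) (u : ℝ) (z : PhaseSpace N) :
    actCentered ω₂ lam β γ T N f u z =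
      (∫ y, f y ∂((pinnedChain ω₂ lam β γ).transitionKernel N T T u.toNNReal z)) -
        ∫ y, f y ∂((pinnedChain ω₂ lam β γ).gibbsMeasure N T) := rfl

/-- Unfolding `poissonField`. -/
theorem poissonField_apply (ω₂ lam β γ T : ℝ) (N : ℕ) (f : PhaseSpace N → ℝ) (z : PhaseSpace N) :
    poissonField ω₂ lam β γ T N f z = ∫ u in Ioi (0 : ℝ), actCentered ω₂ lam β γ T N f u z := rfl

section PoissonField

variable {ω₂ lam β γ : ℝ} (hω : 0 < ω₂) (hl : 0 ≤ lam) (hβ : 0 < β) (hγ : 0 < γ) {N : ℕ} (hN : 0 < N)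
  {T : ℝ} (hT : 0 < T)
include hω hl hβ hγ hN hT

/-- **Uniform exponential decay of `P_u f − μ_T(f)`**: for `0 < ϑ < 1/T` there are `C, c > 0` such that
for every `M > 0` and every continuous `f` with `|f| ≤ M e^{ϑH}`:
`|P_{u⁺} f(z) − μ_T(f)| ≤ M C e^{ϑH(z)} e^{−cu}` for ALL real `u` (for `u ≤ 0`, `P_{u⁺} = P_0` and
`e^{−cu} ≥ 1`). The constants come from the proved exponential ergodicity
`pinnedChain_exp_convergence_gibbs`. -/
theorem abs_actCentered_le {ϑ : ℝ} (hϑ0 : 0 < ϑ) (hϑ1 : ϑ < 1 / T) :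
    ∃ C c : ℝ, 0 < C ∧ 0 < c ∧ ∀ (M : ℝ), 0 < M → ∀ f : PhaseSpace N → ℝ, Continuous f →
      (∀ y, |f y| ≤ M * Real.exp (ϑ * (pinnedChain ω₂ lam β γ).hamiltonian N y)) →
      ∀ (z : PhaseSpace N) (u : ℝ), |actCentered ω₂ lam β γ T N f u z| ≤
          M * C * Real.exp (ϑ * (pinnedChain ω₂ lam β γ).hamiltonian N z) * Real.exp (-c * u) := by
  obtain ⟨C, c, hC, hc, hconv⟩ := pinnedChain_exp_convergence_gibbs hω hl hβ hγ hN hT hϑ0 hϑ1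
  refine ⟨C, c, hC, hc, fun M hM f hf hfb z u => ?_⟩
  have hf' : Continuous fun y => M⁻¹ * f y := continuous_const.mul hf
  have hfb' : ∀ y, |M⁻¹ * f y| ≤ Real.exp (ϑ * (pinnedChain ω₂ lam β γ).hamiltonian N y) := fun y => by
    rw [abs_mul, abs_of_pos (inv_pos.2 hM), inv_mul_le_iff₀ hM]
    exact hfb y
  have h := hconv z u.toNNReal _ hf' hfb'
  rw [integral_const_mul, integral_const_mul, ← mul_sub, abs_mul, abs_of_pos (inv_pos.2 hM),
    inv_mul_le_iff₀ hM] at h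
  have hexp : Real.exp (-c * (u.toNNReal : ℝ)) ≤ Real.exp (-c * u) := by
    refine Real.exp_le_exp.2 ?_
    have : u ≤ (u.toNNReal : ℝ) := Real.le_coe_toNNReal u
    nlinarith
  rw [actCentered_apply]
  calc _ ≤ M * (C * Real.exp (ϑ * (pinnedChain ω₂ lam β γ).hamiltonian N z) *
        Real.exp (-c * (u.toNNReal : ℝ))) := h
    _ ≤ M * (C * Real.exp (ϑ * (pinnedChain ω₂ lam β γ).hamiltonian N z) * Real.exp (-c * u)) := by
        gcongr
    _ = _ := by ring

omit hβ hγ hN hT in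
/-- Joint measurability of `(u, z) ↦ P_{u⁺} f(z) − μ_T(f)` for continuous `f`.
(adapted from `pinnedChain_measurable_kinCorr`) -/
theorem stronglyMeasurable_uncurry_actCentered (hβ' : 0 ≤ β) (hγ' : 0 ≤ γ) {f : PhaseSpace N → ℝ}
    (hf : Continuous f) :
    StronglyMeasurable (Function.uncurry (actCentered ω₂ lam β γ T N f)) := by
  let κ₂ : Kernel (ℝ≥0 × PhaseSpace N) (PhaseSpace N) :=
    { toFun := fun p => (pinnedChain ω₂ lam β γ).transitionKernel N T T p.1 p.2
      measurable' := pinnedChain_measurable_transitionKernel hω hl hβ' hγ' N T T }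
  have hG : StronglyMeasurable fun p : ℝ≥0 × PhaseSpace N => ∫ y, f y ∂(κ₂ p) :=
    hf.stronglyMeasurable.integral_kernel (κ := κ₂)
  have h2 : StronglyMeasurable fun q : ℝ × PhaseSpace N => ∫ y, f y ∂(κ₂ (q.1.toNNReal, q.2)) :=
    hG.comp_measurable ((measurable_real_toNNReal.comp measurable_fst).prodMk measurable_snd)
  have h3 : StronglyMeasurable fun q : ℝ × PhaseSpace N =>
      (∫ y, f y ∂(κ₂ (q.1.toNNReal, q.2))) - ∫ y, f y ∂((pinnedChain ω₂ lam β γ).gibbsMeasure N T) :=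
    h2.sub stronglyMeasurable_const
  exact h3

attribute [irreducible] actCentered

omit hβ hγ hN hT in
/-- Measurability in time of `u ↦ P_{u⁺} f(z) − μ_T(f)`. -/
theorem stronglyMeasurable_actCentered_left (hβ' : 0 ≤ β) (hγ' : 0 ≤ γ) {f : PhaseSpace N → ℝ}
    (hf : Continuous f) (z : PhaseSpace N) :
    StronglyMeasurable fun u : ℝ => actCentered ω₂ lam β γ T N f u z :=
  ((stronglyMeasurable_uncurry_actCentered hω hl hβ' hγ' hf).measurable.of_uncurry_right).stronglyMeasurable

omit hβ hγ hN hT in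
/-- Measurability in space of `z ↦ P_{u⁺} f(z) − μ_T(f)`. -/
theorem stronglyMeasurable_actCentered_right (hβ' : 0 ≤ β) (hγ' : 0 ≤ γ) {f : PhaseSpace N → ℝ}
    (hf : Continuous f) (u : ℝ) :
    StronglyMeasurable fun z : PhaseSpace N => actCentered ω₂ lam β γ T N f u z :=
  ((stronglyMeasurable_uncurry_actCentered hω hl hβ' hγ' hf).measurable.of_uncurry_left).stronglyMeasurable

/-- The integrand of the Poisson field is integrable in time on `(0, ∞)`. -/
theorem integrableOn_actCentered {ϑ : ℝ} (hϑ0 : 0 < ϑ) (hϑ1 : ϑ < 1 / T) {M : ℝ} (hM : 0 < M)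
    {f : PhaseSpace N → ℝ} (hf : Continuous f)
    (hfb : ∀ y, |f y| ≤ M * Real.exp (ϑ * (pinnedChain ω₂ lam β γ).hamiltonian N y)) (z : PhaseSpace N) :
    IntegrableOn (fun u : ℝ => actCentered ω₂ lam β γ T N f u z) (Ioi 0) := by
  obtain ⟨C, c, -, hc, hb⟩ := abs_actCentered_le hω hl hβ hγ hN hT hϑ0 hϑ1
  refine Integrable.mono' ((exp_neg_integrableOn_Ioi 0 hc).const_mul
    (M * C * Real.exp (ϑ * (pinnedChain ω₂ lam β γ).hamiltonian N z)))
    (stronglyMeasurable_actCentered_left hω hl hβ.le hγ.le hf z).aestronglyMeasurable ?_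
  refine Eventually.of_forall fun u => ?_
  rw [Real.norm_eq_abs]
  exact hb M hM f hf hfb z u

/-- **Weighted sup bound on the Poisson field**: `|G_f(z)| ≤ M C e^{ϑH(z)}`, with `C` depending on
`ϑ` only. -/
theorem abs_poissonField_le {ϑ : ℝ} (hϑ0 : 0 < ϑ) (hϑ1 : ϑ < 1 / T) :
    ∃ C : ℝ, 0 < C ∧ ∀ (M : ℝ), 0 < M → ∀ f : PhaseSpace N → ℝ, Continuous f →
      (∀ y, |f y| ≤ M * Real.exp (ϑ * (pinnedChain ω₂ lam β γ).hamiltonian N y)) →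
      ∀ z : PhaseSpace N, |poissonField ω₂ lam β γ T N f z| ≤
        M * C * Real.exp (ϑ * (pinnedChain ω₂ lam β γ).hamiltonian N z) := by
  obtain ⟨C, c, hC, hc, hb⟩ := abs_actCentered_le hω hl hβ hγ hN hT hϑ0 hϑ1
  refine ⟨C / c, by positivity, fun M hM f hf hfb z => ?_⟩
  rw [poissonField_apply]
  have hI : IntegrableOn (fun u : ℝ => M * C * Real.exp (ϑ * (pinnedChain ω₂ lam β γ).hamiltonian N z) *
      Real.exp (-c * u)) (Ioi 0) :=
    ((exp_neg_integrableOn_Ioi 0 hc).const_mul _)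
  have h1 := norm_integral_le_of_norm_le hI (Eventually.of_forall fun u => by
      rw [Real.norm_eq_abs]
      exact hb M hM f hf hfb z u)
  rw [Real.norm_eq_abs] at h1
  refine h1.trans (le_of_eq ?_)
  rw [integral_const_mul, integral_exp_mul_Ioi (by linarith : -c < 0) 0]
  field_simp
  simp

omit hβ hγ hN hT in
/-- The Poisson field is (strongly) measurable. -/
theorem stronglyMeasurable_poissonField (hβ' : 0 ≤ β) (hγ' : 0 ≤ γ) {f : PhaseSpace N → ℝ}
    (hf : Continuous f) : StronglyMeasurable (poissonField ω₂ lam β γ T N f) :=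
  (stronglyMeasurable_uncurry_actCentered hω hl hβ' hγ' hf).integral_prod_left'
    (μ := (volume : Measure ℝ).restrict (Ioi 0))

/-- **The Poisson field is in `L²(μ_T)`** (`|G_f| ≤ M C e^{ϑH}` with `2ϑ < 1/T`). -/
theorem memLp_poissonField {ϑ : ℝ} (hϑ0 : 0 < ϑ) (h2ϑ : 2 * ϑ < 1 / T) {M : ℝ} (hM : 0 < M)
    {f : PhaseSpace N → ℝ} (hf : Continuous f)
    (hfb : ∀ y, |f y| ≤ M * Real.exp (ϑ * (pinnedChain ω₂ lam β γ).hamiltonian N y)) :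
    MemLp (poissonField ω₂ lam β γ T N f) 2 ((pinnedChain ω₂ lam β γ).gibbsMeasure N T) := by
  have hϑ1 : ϑ < 1 / T := by linarith
  obtain ⟨C, hC, hb⟩ := abs_poissonField_le hω hl hβ hγ hN hT hϑ0 hϑ1
  set w : PhaseSpace N → ℝ := fun z => M * C * Real.exp (ϑ * (pinnedChain ω₂ lam β γ).hamiltonian N z)
    with hw
  have hwc : Continuous w := continuous_const.mul (Real.continuous_exp.comp
    (continuous_const.mul (pinnedChain_continuous_hamiltonian ω₂ lam β γ N)))
  have hw2 : MemLp w 2 ((pinnedChain ω₂ lam β γ).gibbsMeasure N T) := by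
    refine (memLp_two_iff_integrable_sq hwc.aestronglyMeasurable).2 ?_
    have h2 := pinnedChain_integrable_exp_mul_hamiltonian_gibbsMeasure hω hl hβ.le γ N hT h2ϑ
    refine (h2.const_mul ((M * C) ^ 2)).congr (Eventually.of_forall fun z => ?_)
    simp only [hw]
    rw [show (M * C * Real.exp (ϑ * (pinnedChain ω₂ lam β γ).hamiltonian N z)) ^ 2 =
      (M * C) ^ 2 * (Real.exp (ϑ * (pinnedChain ω₂ lam β γ).hamiltonian N z) *
        Real.exp (ϑ * (pinnedChain ω₂ lam β γ).hamiltonian N z)) by ring, ← Real.exp_add]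
    ring_nf
  refine hw2.mono' (stronglyMeasurable_poissonField hω hl hβ.le hγ.le hf).aestronglyMeasurable
    (Eventually.of_forall fun z => ?_)
  rw [Real.norm_eq_abs]
  exact hb M hM f hf hfb z

/-- **Fubini for the Poisson field against a weighted observable**: for continuous `h` with
`|h| ≤ M' e^{ϑ'H}` and `ϑ + ϑ' < 1/T`, `h·G_f ∈ L¹(μ_T)` and
`∫ h G_f dμ_T = ∫_{u>0} ∫ h (P_u f − μ_T f) dμ_T du`. -/
theorem integral_mul_poissonField {ϑ ϑ' : ℝ} (hϑ0 : 0 < ϑ) (hϑ'0 : 0 ≤ ϑ') (hsum : ϑ + ϑ' < 1 / T)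
    {M : ℝ} (hM : 0 < M) {f : PhaseSpace N → ℝ} (hf : Continuous f)
    (hfb : ∀ y, |f y| ≤ M * Real.exp (ϑ * (pinnedChain ω₂ lam β γ).hamiltonian N y))
    {M' : ℝ} {h : PhaseSpace N → ℝ} (hh : Continuous h)
    (hhb : ∀ y, |h y| ≤ M' * Real.exp (ϑ' * (pinnedChain ω₂ lam β γ).hamiltonian N y)) :
    Integrable (fun z => h z * poissonField ω₂ lam β γ T N f z) ((pinnedChain ω₂ lam β γ).gibbsMeasure N T) ∧
    ∫ z, h z * poissonField ω₂ lam β γ T N f z ∂((pinnedChain ω₂ lam β γ).gibbsMeasure N T) =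
      ∫ u in Ioi (0 : ℝ), ∫ z, h z * actCentered ω₂ lam β γ T N f u z
        ∂((pinnedChain ω₂ lam β γ).gibbsMeasure N T) := by
  set P := pinnedChain ω₂ lam β γ with hP
  set μ := P.gibbsMeasure N T with hμ
  set ν : Measure ℝ := (volume : Measure ℝ).restrict (Ioi 0) with hν
  haveI : IsProbabilityMeasure μ := pinnedChain_isProbabilityMeasure_gibbsMeasure hω hl hβ.le γ N hT
  have hϑ1 : ϑ < 1 / T := by linarith
  obtain ⟨C, c, hC, hc, hb⟩ := abs_actCentered_le hω hl hβ hγ hN hT hϑ0 hϑ1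
  -- the jointly measurable integrand on `Ω × (0,∞)`
  set F : PhaseSpace N × ℝ → ℝ := fun q => h q.1 * actCentered ω₂ lam β γ T N f q.2 q.1 with hF
  have hA : StronglyMeasurable fun q : PhaseSpace N × ℝ => actCentered ω₂ lam β γ T N f q.2 q.1 :=
    (stronglyMeasurable_uncurry_actCentered hω hl hβ.le hγ.le hf).comp_measurable measurable_swap
  have hFm : StronglyMeasurable F := ((hh.comp continuous_fst).stronglyMeasurable).mul hA
  -- integrable majorant `e^{(ϑ+ϑ')H(z)} · (M C M' e^{-cu})`
  have hwint : Integrable (fun z => Real.exp ((ϑ + ϑ') * P.hamiltonian N z)) μ :=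
    pinnedChain_integrable_exp_mul_hamiltonian_gibbsMeasure hω hl hβ.le γ N hT hsum
  have hmaj : Integrable (fun q : PhaseSpace N × ℝ => Real.exp ((ϑ + ϑ') * P.hamiltonian N q.1) *
      (M * C * M' * Real.exp (-c * q.2))) (μ.prod ν) :=
    Integrable.mul_prod hwint (((exp_neg_integrableOn_Ioi 0 hc).const_mul (M * C * M')))
  have hFint : Integrable F (μ.prod ν) := by
    refine hmaj.mono' hFm.aestronglyMeasurable (Eventually.of_forall fun q => ?_)
    simp only [hF]
    rw [Real.norm_eq_abs, abs_mul]
    have h1 := hhb q.1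
    have h2 := hb M hM f hf hfb q.1 q.2
    have hM'0 : 0 ≤ M' * Real.exp (ϑ' * P.hamiltonian N q.1) := (abs_nonneg _).trans h1
    calc |h q.1| * |actCentered ω₂ lam β γ T N f q.2 q.1|
        ≤ (M' * Real.exp (ϑ' * P.hamiltonian N q.1)) *
            (M * C * Real.exp (ϑ * P.hamiltonian N q.1) * Real.exp (-c * q.2)) :=
          mul_le_mul h1 h2 (abs_nonneg _) hM'0
      _ = Real.exp ((ϑ + ϑ') * P.hamiltonian N q.1) * (M * C * M' * Real.exp (-c * q.2)) := by
          rw [add_mul, Real.exp_add]; ring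
  -- pointwise: `h z · G_f(z) = ∫_u F(z, u)`
  have hfun : (fun z => h z * poissonField ω₂ lam β γ T N f z) = fun z => ∫ u, F (z, u) ∂ν := by
    funext z
    simp only [hF, poissonField_apply]
    rw [← integral_const_mul]
  refine ⟨?_, ?_⟩
  · rw [hfun]
    exact hFint.integral_prod_left
  · rw [hfun, ← integral_prod _ hFint, integral_prod_symm _ hFint]

/-- For fixed `u`, `z ↦ P_{u⁺} f(z) − μ_T(f)` is `μ_T`-integrable with integral `0` (kernel invariance
of the Gibbs measure). -/
theorem integral_actCentered {ϑ : ℝ} (hϑ0 : 0 < ϑ) (hϑ1 : ϑ < 1 / T) {M : ℝ} (hM : 0 < M)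
    {f : PhaseSpace N → ℝ} (hf : Continuous f)
    (hfb : ∀ y, |f y| ≤ M * Real.exp (ϑ * (pinnedChain ω₂ lam β γ).hamiltonian N y)) (u : ℝ) :
    Integrable (fun z => actCentered ω₂ lam β γ T N f u z) ((pinnedChain ω₂ lam β γ).gibbsMeasure N T) ∧
    ∫ z, actCentered ω₂ lam β γ T N f u z ∂((pinnedChain ω₂ lam β γ).gibbsMeasure N T) = 0 := by
  haveI : IsProbabilityMeasure ((pinnedChain ω₂ lam β γ).gibbsMeasure N T) :=
    pinnedChain_isProbabilityMeasure_gibbsMeasure hω hl hβ.le γ N hT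
  obtain ⟨C, c, -, -, hb⟩ := abs_actCentered_le hω hl hβ hγ hN hT hϑ0 hϑ1
  have hexpint := pinnedChain_integrable_exp_mul_hamiltonian_gibbsMeasure hω hl hβ.le γ N hT hϑ1
  have hint : Integrable (fun z => actCentered ω₂ lam β γ T N f u z)
      ((pinnedChain ω₂ lam β γ).gibbsMeasure N T) := by
    refine (hexpint.const_mul (M * C * Real.exp (-c * u))).mono'
      (stronglyMeasurable_actCentered_right hω hl hβ.le hγ.le hf u).aestronglyMeasurable
      (Eventually.of_forall fun z => ?_)
    rw [Real.norm_eq_abs]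
    exact (hb M hM f hf hfb z u).trans (le_of_eq (by ring))
  have hfμ : Integrable f ((pinnedChain ω₂ lam β γ).gibbsMeasure N T) := integrable_of_abs_le_exp hexpint hf hfb
  refine ⟨hint, ?_⟩
  have hact : Integrable (fun z => ∫ y, f y ∂((pinnedChain ω₂ lam β γ).transitionKernel N T T u.toNNReal z))
      ((pinnedChain ω₂ lam β γ).gibbsMeasure N T) := by
    have := hint.add (integrable_const (∫ y, f y ∂((pinnedChain ω₂ lam β γ).gibbsMeasure N T)))
    refine this.congr (Eventually.of_forall fun z => ?_)
    simp only [Pi.add_apply, actCentered_apply, sub_add_cancel]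
  simp only [actCentered_apply]
  rw [integral_sub hact (integrable_const _), integral_const,
    pinnedChain_integral_transitionKernel_gibbsMeasure hω hl hβ.le hγ.le hN hT _ hfμ]
  simp [probReal_univ]

/-- **The Poisson field has mean zero.** -/
theorem integral_poissonField {ϑ : ℝ} (hϑ0 : 0 < ϑ) (hϑ1 : ϑ < 1 / T) {M : ℝ} (hM : 0 < M)
    {f : PhaseSpace N → ℝ} (hf : Continuous f)
    (hfb : ∀ y, |f y| ≤ M * Real.exp (ϑ * (pinnedChain ω₂ lam β γ).hamiltonian N y)) :
    ∫ z, poissonField ω₂ lam β γ T N f z ∂((pinnedChain ω₂ lam β γ).gibbsMeasure N T) = 0 := by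
  have h1 : ∀ y : PhaseSpace N, |(1 : ℝ)| ≤ 1 * Real.exp (0 * (pinnedChain ω₂ lam β γ).hamiltonian N y) :=
    fun y => by simp
  have hsum : ϑ + 0 < 1 / T := by simpa using hϑ1
  obtain ⟨-, hfub⟩ := integral_mul_poissonField hω hl hβ hγ hN hT hϑ0 le_rfl hsum hM hf hfb
    continuous_const h1
  simp only [one_mul] at hfub
  rw [hfub]
  refine (integral_congr_ae (Eventually.of_forall fun u => ?_)).trans (integral_zero _ _)
  exact (integral_actCentered hω hl hβ hγ hN hT hϑ0 hϑ1 hM hf hfb u).2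

/-- **Dominated convergence for Poisson fields**: if continuous `f_n → f` pointwise with a common bound
`|f_n| ≤ M e^{ϑH}` (`0 < ϑ < 1/T`), then `G_{f_n}(z) → G_f(z)` for every `z`. -/
theorem tendsto_poissonField {ϑ : ℝ} (hϑ0 : 0 < ϑ) (hϑ1 : ϑ < 1 / T) {M : ℝ} (hM : 0 < M)
    {f : PhaseSpace N → ℝ} {fs : ℕ → PhaseSpace N → ℝ} (hfs : ∀ n, Continuous (fs n))
    (hfsb : ∀ n y, |fs n y| ≤ M * Real.exp (ϑ * (pinnedChain ω₂ lam β γ).hamiltonian N y))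
    (hlim : ∀ y, Tendsto (fun n => fs n y) atTop (𝓝 (f y))) (z : PhaseSpace N) :
    Tendsto (fun n => poissonField ω₂ lam β γ T N (fs n) z) atTop
      (𝓝 (poissonField ω₂ lam β γ T N f z)) := by
  set P := pinnedChain ω₂ lam β γ with hP
  set μ := P.gibbsMeasure N T with hμ
  obtain ⟨C, c, -, hc, hb⟩ := abs_actCentered_le hω hl hβ hγ hN hT hϑ0 hϑ1
  -- convergence of the means and of the kernel images
  have hexpμ := pinnedChain_integrable_exp_mul_hamiltonian_gibbsMeasure hω hl hβ.le γ N hT hϑ1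
  have hmean : Tendsto (fun n => ∫ y, fs n y ∂μ) atTop (𝓝 (∫ y, f y ∂μ)) :=
    tendsto_integral_of_dominated_convergence (fun y => M * Real.exp (ϑ * P.hamiltonian N y))
      (fun n => (hfs n).aestronglyMeasurable) (hexpμ.const_mul M)
      (fun n => Eventually.of_forall fun y => by rw [Real.norm_eq_abs]; exact hfsb n y)
      (Eventually.of_forall hlim)
  have hact : ∀ u : ℝ, Tendsto (fun n => ∫ y, fs n y ∂(P.transitionKernel N T T u.toNNReal z)) atTop
      (𝓝 (∫ y, f y ∂(P.transitionKernel N T T u.toNNReal z))) := fun u =>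
    tendsto_integral_of_dominated_convergence (fun y => M * Real.exp (ϑ * P.hamiltonian N y))
      (fun n => (hfs n).aestronglyMeasurable)
      ((pinnedChain_integrable_exp_mul_hamiltonian_transitionKernel hω hl hT hβ.le hγ.le hN hϑ0 hϑ1
        _ z).const_mul M)
      (fun n => Eventually.of_forall fun y => by rw [Real.norm_eq_abs]; exact hfsb n y)
      (Eventually.of_forall hlim)
  -- dominated convergence in time
  simp only [poissonField_apply]
  refine tendsto_integral_of_dominated_convergence
    (fun u => M * C * Real.exp (ϑ * P.hamiltonian N z) * Real.exp (-c * u))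
    (fun n => (stronglyMeasurable_actCentered_left hω hl hβ.le hγ.le (hfs n) z).aestronglyMeasurable)
    ((exp_neg_integrableOn_Ioi 0 hc).const_mul _)
    (fun n => Eventually.of_forall fun u => by rw [Real.norm_eq_abs]; exact hb M hM _ (hfs n) (hfsb n) z u)
    (Eventually.of_forall fun u => ?_)
  simp only [actCentered_apply]
  exact (hact u).sub hmean

end PoissonField

/-! ## Registered helper sub-goal -/

/-- Registered helper sub-goal `helper_plainKuboPoissonPairing` (= `integral_mul_poissonField` in stub
form, with `poissonField` unfolded): Fubini for the equilibrium Poisson field against a weighted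
observable, `∫ h G_f dμ_T = ∫_{u>0} ∫ h (P_u f − μ_T f) dμ_T du`. -/
theorem helper_plainKuboPoissonPairing : ∀ {ω₂ lam β γ : ℝ}, 0 < ω₂ → 0 ≤ lam → 0 < β → 0 < γ → ∀ {N : ℕ}, 0 < N → ∀ {T : ℝ}, 0 < T → ∀ {ϑ ϑ' : ℝ}, 0 < ϑ → 0 ≤ ϑ' → ϑ + ϑ' < 1 / T → ∀ {M : ℝ}, 0 < M → ∀ {f : PhaseSpace N → ℝ}, Continuous f → (∀ y, |f y| ≤ M * Real.exp (ϑ * (pinnedChain ω₂ lam β γ).hamiltonian N y)) → ∀ {M' : ℝ} {h : PhaseSpace N → ℝ}, Continuous h → (∀ y, |h y| ≤ M' * Real.exp (ϑ' * (pinnedChain ω₂ lam β γ).hamiltonian N y)) → ∫ z, h z * (∫ u in Set.Ioi (0 : ℝ), ((∫ y, f y ∂((pinnedChain ω₂ lam β γ).transitionKernel N T T u.toNNReal z)) - ∫ y, f y ∂((pinnedChain ω₂ lam β γ).gibbsMeasure N T))) ∂((pinnedChain ω₂ lam β γ).gibbsMeasure N T) = ∫ u in Set.Ioi (0 : ℝ),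 ∫ z, h z * ((∫ y, f y ∂((pinnedChain ω₂ lam β γ).transitionKernel N T T u.toNNReal z)) - ∫ y, f y ∂((pinnedChain ω₂ lam β γ).gibbsMeasure N T)) ∂((pinnedChain ω₂ lam β γ).gibbsMeasure N T) := by
  intro ω₂ lam β γ hω hl hβ hγ N hN T hT ϑ ϑ' hϑ0 hϑ'0 hsum M hM f hf hfb M' h hh hhb
  have h2 := (integral_mul_poissonField hω hl hβ hγ hN hT hϑ0 hϑ'0 hsum hM hf hfb hh hhb).2
  simp only [poissonField_apply, actCentered_apply] at h2
  exact h2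

end Summit.AtomisticToContinuum.FouriersLaw.Cruxes.SuperadditiveResistance.FloatingProbeBypassLaplacian

end
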